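import Summits.ResolutionOfSingularities.ResolutionOfSingularities.Theses.RadicialJung
import HarnessLib

/-!
# `RadicialJung.Assembly` (stmt-ResolutionOfSingularities-15905) — PROVED

Route `ResolutionOfSingularities/RadicialJung`, item `Assembly` (rank 1):

  `CleanModels → Pialt → CleanModelsSuffice → ResolutionOfSingularities`.

Pure logic: this 3-chain is literally the type of the route's deciding theorem
`Theses.RadicialJung.closes` — fix a prime `p`; `CleanModelsSuffice p hp` consumes `Pialt` and
`CleanModels` specialised at `p` (its two antecedents are their bodies verbatim) and yields
`ResolutionInChar p`; `ResolutionOfSingularities_iff` (Statement file) folds the primes back into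
the summit statement.
-/

-- single-problem summit: the doubled namespace component `ResolutionOfSingularities` is forced
set_option linter.dupNamespace false

namespace Summit.ResolutionOfSingularities.ResolutionOfSingularities.Theorems

/-- **`RadicialJung.Assembly` holds** (stmt-ResolutionOfSingularities-15905): log-clean regular
models of height-one radicial covers (`CleanModels`), purely inseparable regular alterations
(`Pialt`) and the per-prime sufficiency of log-clean models (`CleanModelsSuffice`) together imply
the summit statement `ResolutionOfSingularities`. Proof: prime by prime, `CleanModelsSuffice p hp`
applied to the bodies of `Pialt` and `CleanModels` at `p` gives `ResolutionInChar p`; fold with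
`ResolutionOfSingularities_iff`. [folklore] -/
theorem radicialJung_assembly_proof :
    Summit.ResolutionOfSingularities.ResolutionOfSingularities.Theses.RadicialJung.Assembly := by
  unfold Theses.RadicialJung.Assembly
  intro hC hP hS
  exact _root_.ResolutionOfSingularities_iff.mpr fun p hp => hS p hp (hP p hp) (hC p hp)

end Summit.ResolutionOfSingularities.ResolutionOfSingularities.Theorems
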